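import Summits.ValiantsHypothesis.ValiantsHypothesis.Theorems.GrenetZeonDualUnipotentThreeHalvesWordDefs

/-!
# `GrenetZeon.DualUnipotentThreeHalves` (stmt-ValiantsHypothesis-24318), R2 `HeavyTopLaw`, LINE β `half_speed`
# (`Cruxes/DualUnipotentThreeHalves/Lines/half_speed.lean`; card `Ideas/half-speed-tradeoff.md`, val-idea-30 g0): DEFINITIONS (D)

The Theorems-side vocabulary of the line (so that stub closers under `Theorems/` can state the registered stubs verbatim — the
(D)/(P) discipline of `…HeavyTopKrylovSeedDefs`): `gword` (two-letter words over any finite index type; = `RadicalSplit.word` on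
`Fin m`), `HalfSpeed Θ U T` (every non-zero word in `P ∈ U`, `Q ∈ T` has `#Q ≤ Θ + #P` — the word-tame profile `(r,c,Θ) = (1,1,Θ)`),
`glue U₁ U₂` (block-triangular gluing), and the two laws as `Prop`s (NOT asserted): `HalfSpeedLaw` (S⁺, format-free:
`Θ · codim_U T ≤ C · d²`) and `HalfSpeedIrrLaw` (C⁺, the same on IRREDUCIBLE nilpotent spaces — the line's research rung).
Texts: the card block of val-idea-30 (typed by the β pen val-port-4 g2; desk RULING #319 (b)/#320, director R287 (2)(b)).

HONEST LABEL: definitions only; nothing here bears on R2 / 24318 / 8062; `VP ≠ VNP` is NOT proved.  No named facts.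
-/

noncomputable section

-- single-conjunct layout: Sub = Summit, duplicated namespace component intended
set_option linter.dupNamespace false

namespace Summit.ValiantsHypothesis.ValiantsHypothesis.Theorems.GrenetZeon.HalfSpeed

open MvPolynomial Matrix
open scoped BigOperators
open Summit.ValiantsHypothesis.ValiantsHypothesis.Cruxes.TwoDimCoefficients.DimTwoCases (AffMat IsAffine)
open Summit.ValiantsHypothesis.ValiantsHypothesis.Theorems.GrenetZeon.RadicalSplit

/-! ## Objects -/

/-- The word of a Boolean list in two letters over ANY finite index type (`true ↦ Q`, `false ↦ P`; on `Fin m` this is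
`RadicalSplit.word P Q` by `rfl`, see `gword_eq_word`). -/
def gword {ι : Type*} [Fintype ι] [DecidableEq ι] (P Q : Matrix ι ι ℂ) (w : List Bool) : Matrix ι ι ℂ :=
  (w.map fun b => if b then Q else P).prod

/-- **HALF-SPEED with height `Θ`**: every NON-ZERO word in a letter `P ∈ U` and a letter `Q ∈ T` has `#Q ≤ Θ + #P`
(the word-tame profile `(r, c, Θ) = (1, 1, Θ)`: the `Q`-letters advance at most «half speed plus `Θ`»). -/
def HalfSpeed {ι : Type*} [Fintype ι] [DecidableEq ι] (Θ : ℕ) (U T : Set (Matrix ι ι ℂ)) : Prop :=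
  ∀ P ∈ U, ∀ Q ∈ T, ∀ w : List Bool, gword P Q w ≠ 0 → w.count true ≤ Θ + w.count false

/-- **Block-triangular gluing** of two sets of matrices: `{[[A, B], [0, D]] : A ∈ U₁, D ∈ U₂, B arbitrary}`. -/
def glue {ι₁ ι₂ : Type*} (U₁ : Set (Matrix ι₁ ι₁ ℂ)) (U₂ : Set (Matrix ι₂ ι₂ ℂ)) :
    Set (Matrix (ι₁ ⊕ ι₂) (ι₁ ⊕ ι₂) ℂ) :=
  {M | ∃ A ∈ U₁, ∃ D ∈ U₂, ∃ B : Matrix ι₁ ι₂ ℂ, M = Matrix.fromBlocks A B 0 D}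

/-! ## Statements -/

/-- **S⁺ — THE HALF-SPEED TRADEOFF LAW** (format-free): for every linear space `U ⊆ M_d(ℂ)` of nilpotent matrices and every
height `1 ≤ Θ ≤ d` there is `T ≤ U` with `Θ · codim_U T ≤ C · d²` and `HalfSpeed Θ U T`. -/
def HalfSpeedLaw : Prop :=
  ∃ C : ℕ, ∀ (d : ℕ) (U : Submodule ℂ (Matrix (Fin d) (Fin d) ℂ)), (∀ A ∈ U, IsNilpotent A) →
    ∀ Θ : ℕ, 1 ≤ Θ → Θ ≤ d →
      ∃ T : Submodule ℂ (Matrix (Fin d) (Fin d) ℂ), T ≤ U ∧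
        Θ * (Module.finrank ℂ U - Module.finrank ℂ T) ≤ C * d ^ 2 ∧
        HalfSpeed Θ (U : Set (Matrix (Fin d) (Fin d) ℂ)) (T : Set (Matrix (Fin d) (Fin d) ℂ))

/-- **C⁺ — THE HALF-SPEED LAW ON IRREDUCIBLE SPACES** (the transferred crux of this line; research rung): S⁺ for the
linear spaces of nilpotent matrices that act IRREDUCIBLY on `ℂ^d` (no invariant subspace other than `0`, `ℂ^d`). -/
def HalfSpeedIrrLaw : Prop :=
  ∃ C : ℕ, ∀ (d : ℕ) (U : Submodule ℂ (Matrix (Fin d) (Fin d) ℂ)), (∀ A ∈ U, IsNilpotent A) →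
    (∀ V : Submodule ℂ (Fin d → ℂ), (∀ A ∈ U, ∀ x ∈ V, A *ᵥ x ∈ V) → V = ⊥ ∨ V = ⊤) →
    ∀ Θ : ℕ, 1 ≤ Θ → Θ ≤ d →
      ∃ T : Submodule ℂ (Matrix (Fin d) (Fin d) ℂ), T ≤ U ∧
        Θ * (Module.finrank ℂ U - Module.finrank ℂ T) ≤ C * d ^ 2 ∧
        HalfSpeed Θ (U : Set (Matrix (Fin d) (Fin d) ℂ)) (T : Set (Matrix (Fin d) (Fin d) ℂ))

end Summit.ValiantsHypothesis.ValiantsHypothesis.Theorems.GrenetZeon.HalfSpeed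

end
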